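import Summits.CriticalPhenomena.Ising3D.Control2DCellSound2
import Mathlib.Tactic.NormNum
import HarnessLib

/-!
# The 2D control: soundness of the second-order (C) checker — test, cells, cut lists
(cell `pub-ising3x`, seat controls-1; companion of `Control2DCellSound2.lean`)

HONEST FRAMING: lottery ticket; floor = tightest certified 3D Ising CFT bounds; no exact-solution
claim without a proof.

`quadOK_sound` (the integer quadratic test read in `ℝ` ⇒ `Control2DCellScheme2.quad_nonneg_on`),
`PsiC_nonneg_of_quadOK` (one cell), `checkSpin2_sound` (a cut list with pre-point / previous-point left
stencils), `cellPositive_of_checkSpin2` (obligation (C) on the range of the list for a point functional at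
`Δ_σ = 1/8` whose above-threshold obligation holds). All PROVED.
-/

namespace Summit.CriticalPhenomena.Ising3D.Control2D

open Set Finset
open Literature.MathematicalPhysics.QuantumFieldTheory.ConformalBootstrap3D

/-! ### The quadratic test -/

/-- **`quadOK ⇒ A + Bτ + Cτ² ≥ 0` on `[0, H]`** (integers read in `ℝ`). [folklore] -/
theorem quadOK_sound {S : ℤ × ℤ × ℤ} {H : ℚ} (hq : quadOK S H = true) (dH : dyOK H = true) (hH : 0 < H)
    {τ : ℝ} (hτ0 : 0 ≤ τ) (hτ1 : τ ≤ (H : ℝ)) :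
    0 ≤ (S.1 : ℝ) + (S.2.1 : ℝ) * τ + (S.2.2 : ℝ) * τ ^ 2 := by
  simp only [quadOK, Bool.and_eq_true, Bool.or_eq_true, decide_eq_true_eq] at hq
  obtain ⟨⟨h0, hend⟩, hv⟩ := hq
  have eHr := dy_cast dH
  set n : ℝ := (dyNum H : ℝ) with hn
  set p : ℝ := (2 : ℝ) ^ dyExp H with hp
  have hp0 : 0 < p := by rw [hp]; positivity
  have hHr : (H : ℝ) = n / p := eHr
  have hHpos : (0 : ℝ) < (H : ℝ) := by exact_mod_cast hH
  -- read the integer facts in ℝ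
  have h0' : (0 : ℝ) ≤ S.1 := by exact_mod_cast h0
  have hend' : (0 : ℝ) ≤ S.1 * (p * p) + S.2.1 * n * p + S.2.2 * (n * n) := by
    have := hend
    have e : ((((2 ^ dyExp H : ℕ) : ℤ)) : ℝ) = p := by rw [hp]; push_cast; ring
    have : (0 : ℝ) ≤ ((S.1 * ((((2 ^ dyExp H : ℕ) : ℤ)) * (((2 ^ dyExp H : ℕ) : ℤ))) +
        S.2.1 * ((dyNum H : ℕ) : ℤ) * (((2 ^ dyExp H : ℕ) : ℤ)) + S.2.2 * (((dyNum H : ℕ) : ℤ) * ((dyNum H : ℕ) : ℤ)) : ℤ) : ℝ) := by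
      exact_mod_cast this
    push_cast at this
    rw [hp, hn]
    convert this using 2
  have hendR : 0 ≤ (S.1 : ℝ) + S.2.1 * (H : ℝ) + S.2.2 * (H : ℝ) ^ 2 := by
    rw [hHr]
    have : (S.1 : ℝ) + S.2.1 * (n / p) + S.2.2 * (n / p) ^ 2 =
        (S.1 * (p * p) + S.2.1 * n * p + S.2.2 * (n * n)) / (p * p) := by
      field_simp
    rw [this]; positivity
  have hvR : (S.2.2 : ℝ) ≤ 0 ∨ (0 : ℝ) ≤ S.2.1 ∨ (S.2.1 : ℝ) + 2 * S.2.2 * (H : ℝ) ≤ 0 ∨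
      (S.2.1 : ℝ) ^ 2 ≤ 4 * S.1 * S.2.2 := by
    rcases hv with ((hc | hb) | hr) | hd
    · left; exact_mod_cast hc
    · right; left; exact_mod_cast hb
    · right; right; left
      have : ((S.2.1 * (((2 ^ dyExp H : ℕ) : ℤ)) + 2 * S.2.2 * ((dyNum H : ℕ) : ℤ) : ℤ) : ℝ) ≤ 0 := by
        exact_mod_cast hr
      push_cast at this
      rw [hHr]
      have e : (S.2.1 : ℝ) + 2 * S.2.2 * (n / p) = (S.2.1 * p + 2 * S.2.2 * n) / p := by field_simp
      rw [e]
      exact div_nonpos_of_nonpos_of_nonneg (by rw [hp, hn]; convert this using 2) hp0.le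
    · right; right; right
      have : ((S.2.1 * S.2.1 : ℤ) : ℝ) ≤ ((4 * S.1 * S.2.2 : ℤ) : ℝ) := by exact_mod_cast hd
      push_cast at this; nlinarith
  exact quad_nonneg_on hHpos h0' hendR hvR hτ0 hτ1

/-! ### One cell and a cut list -/

/-- **One cell.** [folklore] -/
theorem PsiC_nonneg_of_quadOK {P N ℓ : ℕ} {vals : List ℚ} {cds : List CDat} {rds : List RDat}
    (h : List.Forall₂ (CDat.Models P vals ℓ) cds rds) (hok : ∀ r ∈ rds, r.ok) {useD0 : Bool}
    {tm t₀ t₁ t₂ : ℝ} (hℓ0 : (ℓ : ℝ) ≤ t₀) (hm : useD0 = true → (ℓ : ℝ) ≤ tm ∧ tm < t₀)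
    (h01 : t₀ < t₁) (h12 : t₁ < t₂)
    {H0 H H3 : ℚ} (hH0 : useD0 = true → dyOK H0 = true ∧ (H0 : ℝ) = t₀ - tm) (dH : dyOK H = true)
    (dH3 : dyOK H3 = true) (eH : (H : ℝ) = t₁ - t₀) (eH3 : (H3 : ℝ) = t₂ - t₁)
    {pm p0 p1 p2 : List (NI × NI)}
    (hpm : List.Forall₂ (fun pr r => useD0 = true →
      (pr.1.mem P (fC r.x r.y tm) ∧ pr.2.mem P (brR N ℓ tm r.x r.y))) pm rds)
    (hp0 : List.Forall₂ (fun pr r => pr.1.mem P (fC r.x r.y t₀) ∧ pr.2.mem P (brR N ℓ t₀ r.x r.y)) p0 rds)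
    (hp1 : List.Forall₂ (fun pr r => pr.1.mem P (fC r.x r.y t₁) ∧ pr.2.mem P (brR N ℓ t₁ r.x r.y)) p1 rds)
    (hp2 : List.Forall₂ (fun pr r => pr.1.mem P (fC r.x r.y t₂) ∧ pr.2.mem P (brR N ℓ t₂ r.x r.y)) p2 rds)
    (hq : quadOK (sums6 P useD0 H0 H H3 cds pm p0 p1 p2) H = true) :
    ∀ Δ ∈ Icc t₀ t₁, 0 ≤ PsiC rds N ℓ Δ := by
  intro Δ hΔ
  have hHp : 0 < H := by
    have : (0 : ℝ) < (H : ℝ) := by rw [eH]; linarith [h01]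
    exact_mod_cast this
  obtain ⟨s1, s2, s3⟩ := sums6_spec h hok hℓ0 hm h01 h12 hH0 dH dH3 eH eH3 hpm hp0 hp1 hp2
  set τ := Δ - t₀ with hτ
  have hτ0 : 0 ≤ τ := by rw [hτ]; linarith [hΔ.1]
  have hτ1 : τ ≤ t₁ - t₀ := by rw [hτ]; linarith [hΔ.2]
  have hq' := quadOK_sound hq dH hHp hτ0 (by rw [eH]; exact hτ1)
  have hlb := quadLB_le_PsiC' hok N ℓ useD0 hℓ0 hm h01 h12 hτ0 hτ1
  rw [quadLB_eq] at hlb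
  have e : t₀ + τ = Δ := by rw [hτ]; ring
  rw [e] at hlb
  have h2P : (0 : ℝ) < 2 ^ P := pow_pos two_pos P
  -- (A + Bτ + Cτ²)·2^P ≥ S.1 + S.2.1 τ + S.2.2 τ² ≥ 0
  have hτ2 : 0 ≤ τ ^ 2 := sq_nonneg τ
  have k : 0 ≤ (Aq rds N ℓ t₀ t₁ t₂ + Bq rds N ℓ useD0 tm t₀ t₁ t₂ * τ +
      Cq rds N ℓ useD0 tm t₀ t₁ t₂ * τ ^ 2) * 2 ^ P := by
    nlinarith [mul_le_mul_of_nonneg_right s2 hτ0, mul_le_mul_of_nonneg_right s3 hτ2, hq', s1]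
  have k' := (mul_nonneg_iff_of_pos_right h2P).mp k
  linarith

/-- **Soundness of the second-order spin checker**: `Ψ ≥ 0` on `[T₀, T_K]`. [folklore] -/
theorem checkSpin2_sound {P N ℓ : ℕ} {vals : List ℚ} (hvals : ∀ q ∈ vals, 0 ≤ q) {cds : List CDat}
    {rds : List RDat} (h : List.Forall₂ (CDat.Models P vals ℓ) cds rds) (hok : ∀ r ∈ rds, r.ok)
    {usePre : Bool} {pre : ℚ} {T : List ℚ} {extra : ℚ}
    (hc : checkSpin2 P N ℓ (vals.map (NI.ofRat P)) cds usePre pre T extra = true) (hT : 2 ≤ T.length) :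
    ∀ Δ : ℝ, ((T.getD 0 0 : ℚ) : ℝ) ≤ Δ → Δ ≤ ((T.getD (T.length - 1) 0 : ℚ) : ℝ) → 0 ≤ PsiC rds N ℓ Δ := by
  unfold checkSpin2 at hc
  simp only [Bool.and_eq_true] at hc
  obtain ⟨⟨⟨hall, hpre⟩, hinc⟩, hcells⟩ := hc
  set Tx := T ++ [extra] with hTx
  have hTxlen : Tx.length = T.length + 1 := by simp [hTx]
  have hpt : ∀ k, k < Tx.length → dyOK (Tx.getD k 0) = true ∧ (ℓ : ℚ) ≤ Tx.getD k 0 := by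
    intro k hk
    have := of_all_eq_true hall (Tx.getD k 0) (by rw [List.getD_eq_getElem _ _ hk]; exact List.getElem_mem hk)
    simpa [Bool.and_eq_true, decide_eq_true_eq] using this
  have hincr : ∀ k, k < T.length → Tx.getD k 0 < Tx.getD (k + 1) 0 := by
    intro k hk; simpa using allBelow_spec hinc k hk
  have hTTx : ∀ k, k < T.length → T.getD k 0 = Tx.getD k 0 := by
    intro k hk
    rw [hTx, List.getD_eq_getElem _ _ hk, List.getD_eq_getElem _ _ (by simp; omega),
      List.getElem_append_left hk]
  -- dyadicity of differences
  have dsub : ∀ a b : ℚ, dyOK a = true → dyOK b = true → a < b → dyOK (b - a) = true := by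
    intro a b ha hb hab
    simp only [dyOK, Bool.and_eq_true, decide_eq_true_eq] at ha hb ⊢
    refine ⟨by linarith, ?_⟩
    -- the denominator of a difference of dyadics is a power of two
    have hpa := ha.2; have hpb := hb.2
    have key : (b - a).den ∣ 2 ^ (Nat.log2 a.den + Nat.log2 b.den) := by
      have h1 : (b - a).den ∣ b.den * a.den := Rat.sub_den_dvd b a
      rw [hpa, hpb, ← pow_add, add_comm] at h1
      exact h1
    obtain ⟨j, _, hj⟩ := (Nat.dvd_prime_pow Nat.prime_two).1 key
    rw [hj, Nat.log2_two_pow]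
  set PT := Tx.map (pointC P N ℓ (vals.map (NI.ofRat P)) cds) with hPT
  have hP : ∀ j, j < Tx.length → PT.getD j [] = pointC P N ℓ (vals.map (NI.ofRat P)) cds (Tx.getD j 0) := by
    intro j hj
    rw [hPT, List.getD_eq_getElem _ _ (by simpa using hj), List.getElem_map, List.getD_eq_getElem _ _ hj]
  -- each cell
  have hcell : ∀ k, k < T.length - 1 →
      ∀ Δ ∈ Icc (((Tx.getD k 0 : ℚ)) : ℝ) (((Tx.getD (k + 1) 0 : ℚ)) : ℝ), 0 ≤ PsiC rds N ℓ Δ := by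
    intro k hk
    have hk0 : k < Tx.length := by omega
    have hk1 : k + 1 < Tx.length := by omega
    have hk2 : k + 2 < Tx.length := by omega
    have hcq := allBelow_spec hcells k hk
    rw [hP k hk0, hP (k + 1) hk1, hP (k + 2) hk2] at hcq
    have s0 := pointC_spec (N := N) hvals h hok (hpt k hk0).1 (hpt k hk0).2
    have s1 := pointC_spec (N := N) hvals h hok (hpt (k + 1) hk1).1 (hpt (k + 1) hk1).2
    have s2 := pointC_spec (N := N) hvals h hok (hpt (k + 2) hk2).1 (hpt (k + 2) hk2).2
    have i01 : ((Tx.getD k 0 : ℚ) : ℝ) < ((Tx.getD (k + 1) 0 : ℚ) : ℝ) := by exact_mod_cast hincr k (by omega)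
    have i12 : ((Tx.getD (k + 1) 0 : ℚ) : ℝ) < ((Tx.getD (k + 2) 0 : ℚ) : ℝ) := by
      exact_mod_cast hincr (k + 1) (by omega)
    have hℓ0 : (ℓ : ℚ) ≤ Tx.getD k 0 := (hpt k hk0).2
    have dH : dyOK (Tx.getD (k + 1) 0 - Tx.getD k 0) = true :=
      dsub _ _ (hpt k hk0).1 (hpt (k + 1) hk1).1 (hincr k (by omega))
    have dH3 : dyOK (Tx.getD (k + 2) 0 - Tx.getD (k + 1) 0) = true :=
      dsub _ _ (hpt (k + 1) hk1).1 (hpt (k + 2) hk2).1 (hincr (k + 1) (by omega))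
    by_cases hk00 : k = 0
    · -- first cell: left stencil = the pre-point when `usePre`, else slope 0 (no stencil needed)
      subst hk00
      simp only [↓reduceIte] at hcq
      have hℓ0R : (ℓ : ℝ) ≤ ((Tx.getD 0 0 : ℚ) : ℝ) := by exact_mod_cast hℓ0
      by_cases hu : usePre = true
      · subst hu
        simp only [Bool.not_true, Bool.false_or, Bool.and_eq_true, decide_eq_true_eq] at hpre
        obtain ⟨⟨dpre, hℓpre⟩, hlt⟩ := hpre
        rw [hTTx 0 (by omega)] at hlt
        have spre := pointC_spec (N := N) hvals h hok dpre hℓpre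
        have dH0 : dyOK (T.getD 0 0 - pre) = true := by
          rw [hTTx 0 (by omega)]; exact dsub _ _ dpre (hpt 0 hk0).1 hlt
        exact PsiC_nonneg_of_quadOK h hok (useD0 := true) (tm := ((pre : ℚ) : ℝ)) hℓ0R
          (fun _ => ⟨by exact_mod_cast hℓpre, by exact_mod_cast hlt⟩) i01 i12
          (fun _ => ⟨dH0, by rw [hTTx 0 (by omega)]; push_cast; ring⟩) dH dH3
          (by push_cast; ring) (by push_cast; ring)
          (List.Forall₂.imp (fun _ _ hab _ => hab) spre) s0 s1 s2 hcq
      · have hu' : usePre = false := by simpa using hu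
        rw [hu'] at hcq
        -- the pre-point data are never used: a vacuous relation of the right length
        have hlen : (pointC P N ℓ (vals.map (NI.ofRat P)) cds pre).length = rds.length := by
          simp [pointC, h.length_eq]
        have hvac : List.Forall₂ (fun (pr : NI × NI) (r : RDat) => false = true →
            (pr.1.mem P (fC r.x r.y 0) ∧ pr.2.mem P (brR N ℓ 0 r.x r.y)))
            (pointC P N ℓ (vals.map (NI.ofRat P)) cds pre) rds :=
          List.forall₂_of_length_eq_of_get hlen (fun _ _ _ hf => absurd hf (by decide))
        exact PsiC_nonneg_of_quadOK h hok (useD0 := false) (tm := 0) hℓ0R (fun hf => absurd hf (by decide))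
          i01 i12 (fun hf => absurd hf (by decide)) dH dH3 (by push_cast; ring) (by push_cast; ring)
          hvac s0 s1 s2 hcq
    · -- later cells: left stencil = previous cut point
      have hkm : k - 1 < Tx.length := by omega
      simp only [hk00, ↓reduceIte] at hcq
      rw [hP (k - 1) hkm] at hcq
      have sm := pointC_spec (N := N) hvals h hok (hpt (k - 1) hkm).1 (hpt (k - 1) hkm).2
      have hkk : k - 1 + 1 = k := by omega
      have im0 : Tx.getD (k - 1) 0 < Tx.getD k 0 := by
        have := hincr (k - 1) (by omega); rw [hkk] at this; exact this
      have dH0 : dyOK (Tx.getD k 0 - Tx.getD (k - 1) 0) = true := dsub _ _ (hpt (k - 1) hkm).1 (hpt k hk0).1 im0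
      have hℓ0R : (ℓ : ℝ) ≤ ((Tx.getD k 0 : ℚ) : ℝ) := by exact_mod_cast hℓ0
      exact PsiC_nonneg_of_quadOK h hok (useD0 := true) (tm := ((Tx.getD (k - 1) 0 : ℚ) : ℝ)) hℓ0R
        (fun _ => ⟨by exact_mod_cast (hpt (k - 1) hkm).2, by exact_mod_cast im0⟩) i01 i12
        (fun _ => ⟨dH0, by push_cast; ring⟩) dH dH3 (by push_cast; ring) (by push_cast; ring)
        (List.Forall₂.imp (fun _ _ hab _ => hab) sm) s0 s1 s2 hcq
  -- cover
  intro Δ hlo hhi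
  have hK : 1 ≤ T.length - 1 := by omega
  have hcover := nonneg_of_cells (Ψ := PsiC rds N ℓ) (fun k => (((Tx.getD k 0 : ℚ)) : ℝ)) hK
    (fun k hk => hcell k hk) Δ
  refine hcover ⟨?_, ?_⟩
  · rw [← hTTx 0 (by omega)]; exact hlo
  · rw [← hTTx (T.length - 1) (by omega)]; exact hhi

/-- **(C) from the second-order spin checker.** [folklore] -/
theorem cellPositive_of_checkSpin2 {n : ℕ} (w z zb : Fin n → ℚ) (hz : ∀ k, 0 < z k ∧ z k < 1)
    (hzb : ∀ k, 0 < zb k ∧ zb k < 1) (vals : List ℚ) (hvals : ∀ q ∈ vals, 0 ≤ q)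
    (hv : ∀ k, z k ∈ vals ∧ zb k ∈ vals ∧ 1 - z k ∈ vals ∧ 1 - zb k ∈ vals)
    {E₀ : ℝ} (hpair : PairPositiveAbove
      (pointFunctional (fun k => ((w k : ℚ) : ℝ)) (fun k => ((z k : ℚ) : ℝ)) (fun k => ((zb k : ℚ) : ℝ)))
      (1 / 8) E₀)
    (P depth N ℓ : ℕ) (hℓ : Even ℓ) (usePre : Bool) (pre : ℚ) (T : List ℚ) (extra : ℚ) (hT : 2 ≤ T.length)
    (hℓT : (ℓ : ℚ) ≤ T.getD 0 0) (hN : E₀ ≤ ((T.getD 0 0 : ℚ) : ℝ) + N)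
    (hc : checkSpin2 P N ℓ (vals.map (NI.ofRat P)) (mkCData P depth ℓ vals w z zb) usePre pre T extra = true) :
    CellPositive (pointFunctional (fun k => ((w k : ℚ) : ℝ)) (fun k => ((z k : ℚ) : ℝ))
      (fun k => ((zb k : ℚ) : ℝ))) (1 / 8) ℓ ((T.getD 0 0 : ℚ) : ℝ) ((T.getD (T.length - 1) 0 : ℚ) : ℝ) := by
  intro Δ hΔ
  have hz' : ∀ k, ((z k : ℚ) : ℝ) ∈ Ioo (0 : ℝ) 1 := fun k =>
    ⟨by exact_mod_cast (hz k).1, by exact_mod_cast (hz k).2⟩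
  have hzb' : ∀ k, ((zb k : ℚ) : ℝ) ∈ Ioo (0 : ℝ) 1 := fun k =>
    ⟨by exact_mod_cast (hzb k).1, by exact_mod_cast (hzb k).2⟩
  have hφ := evaluationContinuous_pointFunctional (fun k => ((w k : ℚ) : ℝ)) _ _ hz' hzb'
  have hΨ := checkSpin2_sound hvals (mkCData_models P depth ℓ vals w z zb hz hzb hv) (realData_ok w z zb hz hzb)
    hc hT Δ hΔ.1 hΔ.2
  rw [← pointFunctional_QN_eq_PsiC w z zb hz hzb hℓ] at hΨ
  have hℓΔ : (ℓ : ℝ) ≤ Δ := le_trans (by exact_mod_cast hℓT) hΔ.1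
  exact blockPositive_of_QN_nonneg hφ hpair hℓΔ (by linarith [hΔ.1]) hΨ

end Summit.CriticalPhenomena.Ising3D.Control2D
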